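import Literature.NumberTheory.LFunctions.KloostermanFractionsFromC1
import Literature.NumberTheory.LFunctions.KloostermanFractionsC1
import HarnessLib

/-!
# Trilinear forms with Kloosterman fractions: (7.3) from the second moment `𝓒₁` (general `A`)

Topic `NumberTheory/LFunctions`.  S. Bettin, V. Chandee, *Trilinear forms with Kloosterman
fractions*, Adv. Math. 328 (2018) 1234–1262 (arXiv:1502.00769).  For the named fact
`BettinChandee2018_trilinearKloostermanFractions` (their Theorem 1, general `A`;
`BettinChandee2018TrilinearKloostermanFractions.lean`) the file
`TrilinearKloostermanFractionsReciprocity.lean` reduces everything to the bound (7.3) for the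
TWISTED trilinear form `𝓑^{tw} = ∑_a∑_m∑_{n,(m,n)=1} α_m β_n ν_a e(ϑ a m̄/n + η a/(mn))` in the
range `M ≥ N`.  This file PROVES the next two steps down of the printed proof, for general `A`
and with the twist carried along (the tree's `KloostermanFractionsCoprimeReduction.lean`,
`KloostermanFractionsFromC1.lean` are the case `A = 1`, untwisted):

* §2, first sentence — "we can assume that `β_n` is supported on integers coprime to `ϑ`, as can
  be seen by pulling out the common factor between `n` and `ϑ` and applying the Cauchy–Schwarz
  inequality": `BC_triPhase_reduce` (`e(ϑa m̄/(dn') + ηa/(m dn')) = e((ϑ/d)a m̄/n' + (η/d)a/(mn'))`),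
  `BC_trilinear_tw_eq_sum_divisors` (regrouping by `d = (n, ϑ)`),
  `BC_trilinear_tw_bound_of_coprime_case` (Cauchy–Schwarz over `d ∣ ϑ`, cost `τ(|ϑ|)^{1/2}`);
* §2 (bfc) — `𝓑 ≪ ‖α‖ 𝓒₁^{1/2}`: `BC_trilinear_tw_le_norm_mul_sqrt_C1A`;
* §7, (7.1) ⟹ (7.2)/(7.3) — `BC_sqrt_terms64A_le`, `BC_trilinear_tw_of_C1A_bound`, and
  **`BC_twisted73_MgeN_of_C1A_bound`**: the (6.4)-type bound for the twisted trilinear second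
  moment `𝓒₁^{tw}(M,N,A)` (`β` coprime to `ϑ`, `M ≥ N`; Remark 2's factor with exponent `1` at
  the level of second moments) ⟹ the hypothesis (7.3) of
  `BettinChandee2018_trilinearKloostermanFractions_of_twisted73_MgeN`.

So, for the named fact, what remains of the source is §§2 (amplification)–6: the (6.4)-type
bound for `𝓒₁^{tw}(M,N,A)`, i.e. the hypothesis of `BC_twisted73_MgeN_of_C1A_bound`.  No new named
facts (D-0026).

## References

* S. Bettin, V. Chandee, *Trilinear forms with Kloosterman fractions*, Adv. Math. 328 (2018)
  1234–1262, arXiv:1502.00769, §2, §7 ((7.1)–(7.3)), Remark 2. [BettinChandee2018]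
-/

noncomputable section

open Finset Real

namespace Literature.NumberTheory.LFunctions

/-! ### Reduction to `β` supported on `(n, ϑ) = 1` (Bettin–Chandee §2, first sentence) -/

/-- **Pulling out the common factor** for the twisted trilinear phase: for `d, n', m ≥ 1`,
`(m, dn') = 1` and `d ∣ ϑ`,
`e(ϑ a m̄^{(dn')}/(dn') + η a/(m dn')) = e((ϑ/d) a m̄^{(n')}/n' + (η/d) a/(m n'))`
(the tree's `DFI_kloostermanPhase_reduce` with numerator `ϑ a`, and `ηa/(m·dn') = (η/d)a/(mn')`).
[folklore] -/
theorem BC_triPhase_reduce {d n' m : ℕ} (hd : 0 < d) (hn : 0 < n') (hm0 : 0 < m)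
    (hm : m.Coprime (d * n')) {ϑ : ℤ} (hϑ : (d : ℤ) ∣ ϑ) (η : ℝ) (a : ℕ) :
    Complex.exp (2 * Real.pi * Complex.I *
        ((ϑ : ℂ) * (a : ℂ) * ((((m : ZMod (d * n'))⁻¹).val : ℕ) : ℂ) / ((d * n' : ℕ) : ℂ) +
          (η : ℂ) * (a : ℂ) / ((m : ℂ) * ((d * n' : ℕ) : ℂ)))) =
      Complex.exp (2 * Real.pi * Complex.I *
        (((ϑ / d : ℤ) : ℂ) * (a : ℂ) * ((((m : ZMod n')⁻¹).val : ℕ) : ℂ) / (n' : ℂ) +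
          ((η / d : ℝ) : ℂ) * (a : ℂ) / ((m : ℂ) * (n' : ℂ)))) := by
  have key := DFI_kloostermanPhase_reduce hd hn hm (k := ϑ * a) (dvd_mul_of_dvd_left hϑ _)
  have hdz : (d : ℤ) ≠ 0 := by exact_mod_cast hd.ne'
  have hdiv : ϑ * a / d = ϑ / d * a := by
    obtain ⟨c, rfl⟩ := hϑ
    rw [mul_assoc, Int.mul_ediv_cancel_left _ hdz, Int.mul_ediv_cancel_left _ hdz]
  rw [hdiv] at key
  rw [mul_add, mul_add, Complex.exp_add, Complex.exp_add]
  congr 1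
  · have e1 : 2 * (Real.pi : ℂ) * Complex.I *
        ((ϑ : ℂ) * (a : ℂ) * ((((m : ZMod (d * n'))⁻¹).val : ℕ) : ℂ) / ((d * n' : ℕ) : ℂ)) =
        2 * Real.pi * Complex.I *
          (((ϑ * a : ℤ) : ℂ) * ((((m : ZMod (d * n'))⁻¹).val : ℕ) : ℂ) / ((d * n' : ℕ) : ℂ)) := by
      push_cast; ring
    have e2 : 2 * (Real.pi : ℂ) * Complex.I *
        (((ϑ / d : ℤ) : ℂ) * (a : ℂ) * ((((m : ZMod n')⁻¹).val : ℕ) : ℂ) / (n' : ℂ)) =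
        2 * Real.pi * Complex.I *
          (((ϑ / d * a : ℤ) : ℂ) * ((((m : ZMod n')⁻¹).val : ℕ) : ℂ) / (n' : ℂ)) := by
      push_cast; ring
    rw [e1, e2]
    exact key
  · congr 1
    have hd0 : (d : ℂ) ≠ 0 := by exact_mod_cast hd.ne'
    have hm0' : (m : ℂ) ≠ 0 := by exact_mod_cast hm0.ne'
    have hn0' : (n' : ℂ) ≠ 0 := by exact_mod_cast hn.ne'
    push_cast
    field_simp

/-- **The twisted trilinear form regrouped by `d = (n, ϑ)`**:
`𝓑^{tw}(M,N,A;ϑ,η;α,β,ν) = ∑_{d ∣ ϑ} 𝓑^{tw}(M,N/d,A;ϑ/d,η/d; α 1_{(·,d)=1}, β^{(d)}, ν)` with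
`β^{(d)}(n') = β_{dn'} 1_{(n',ϑ/d)=1}` ("pulling out the common factor between `n` and `ϑ`",
Bettin–Chandee §2; the single-numerator case is the tree's `DFI_bilinear_eq_sum_divisors`).
[cite: BettinChandee2018, §2] -/
theorem BC_trilinear_tw_eq_sum_divisors (M N A : ℝ) {ϑ : ℤ} (hϑ : ϑ ≠ 0) (η : ℝ)
    (α β ν : ℕ → ℂ) :
    (∑ a ∈ Icc 1 ⌊2 * A⌋₊, ∑ m ∈ Icc 1 ⌊2 * M⌋₊, ∑ n ∈ Icc 1 ⌊2 * N⌋₊,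
      if m.Coprime n then
        α m * β n * ν a * Complex.exp (2 * Real.pi * Complex.I *
          ((ϑ : ℂ) * (a : ℂ) * ((((m : ZMod n)⁻¹).val : ℕ) : ℂ) / (n : ℂ) +
            (η : ℂ) * (a : ℂ) / ((m : ℂ) * (n : ℂ))))
      else 0) =
    ∑ d ∈ ϑ.natAbs.divisors, ∑ a ∈ Icc 1 ⌊2 * A⌋₊, ∑ m ∈ Icc 1 ⌊2 * M⌋₊,
      ∑ n' ∈ Icc 1 ⌊2 * (N / d)⌋₊,
      if m.Coprime n' then
        (if m.Coprime d then α m else 0) *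
          (if n'.Coprime (ϑ.natAbs / d) then β (d * n') else 0) * ν a *
          Complex.exp (2 * Real.pi * Complex.I *
            (((ϑ / d : ℤ) : ℂ) * (a : ℂ) * ((((m : ZMod n')⁻¹).val : ℕ) : ℂ) / (n' : ℂ) +
              ((η / d : ℝ) : ℂ) * (a : ℂ) / ((m : ℂ) * (n' : ℂ))))
      else 0 := by
  have hK : ϑ.natAbs ≠ 0 := Int.natAbs_ne_zero.mpr hϑ
  conv_rhs => rw [Finset.sum_comm]
  refine Finset.sum_congr rfl fun a _ => ?_
  conv_rhs => rw [Finset.sum_comm]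
  refine Finset.sum_congr rfl fun m hm => ?_
  have hm0 : 0 < m := (Finset.mem_Icc.mp hm).1
  rw [DFI_sum_box_eq_sum_divisors_gcd hK N]
  refine Finset.sum_congr rfl fun d hd => ?_
  have hd0 : 0 < d := Nat.pos_of_mem_divisors hd
  have hdk : (d : ℤ) ∣ ϑ := Int.natCast_dvd.mpr (Nat.dvd_of_mem_divisors hd)
  rw [Finset.sum_filter]
  refine Finset.sum_congr rfl fun n' hn' => ?_
  have hn0 : 0 < n' := (Finset.mem_Icc.mp hn').1
  by_cases hc : n'.Coprime (ϑ.natAbs / d)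
  · rw [if_pos hc, if_pos hc]
    by_cases hmn : m.Coprime (d * n')
    · obtain ⟨hmd, hmn'⟩ := Nat.coprime_mul_iff_right.mp hmn
      rw [if_pos hmn, if_pos hmn', if_pos hmd, BC_triPhase_reduce hd0 hn0 hm0 hmn hdk η a]
    · rw [if_neg hmn]
      by_cases hmn' : m.Coprime n'
      · have hmd : ¬ m.Coprime d := fun h => hmn (Nat.Coprime.mul_right h hmn')
        rw [if_pos hmn', if_neg hmd]; simp
      · rw [if_neg hmn']
  · rw [if_neg hc, if_neg hc]
    split_ifs <;> simp

/-- **Reduction to coprime support for the twisted trilinear form** (Cauchy–Schwarz over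
`d ∣ ϑ`; the single-numerator case is the tree's `DFI_bilinear_bound_of_coprime_case`).  Suppose
that for all `1/2 ≤ N ≤ M`, `A ≥ 1/2`, `ϑ ≠ 0`, real `η`, all `α, ν` on their boxes and all `β`
supported in `(N, 2N]` AND on integers coprime to `ϑ`,
`‖𝓑^{tw}(M,N,A;ϑ,η;α,β,ν)‖ ≤ ‖α‖‖β‖‖ν‖ G(M,N,A,ϑ,η)`, with `G ≥ 0` (on `M, N, A ≥ 1/2`) and
`G(M,N/d,A,ϑ/d,η/d) ≤ G(M,N,A,ϑ,η)` for `1 ≤ d ∣ ϑ` with `N/d ≥ 1/2`.  Then for all `β` supported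
in `(N, 2N]`, `‖𝓑^{tw}‖ ≤ τ(|ϑ|)^{1/2} ‖α‖‖β‖‖ν‖ G(M,N,A,ϑ,η)`
(`∑_{d∣ϑ} ‖β^{(d)}‖² = ‖β‖²`, `DFI_sum_divisors_normSq_eq`). [cite: BettinChandee2018, §2] -/
theorem BC_trilinear_tw_bound_of_coprime_case (G : ℝ → ℝ → ℝ → ℤ → ℝ → ℝ)
    (hG0 : ∀ (M N A : ℝ) (ϑ : ℤ) (η : ℝ), 1 / 2 ≤ M → 1 / 2 ≤ N → 1 / 2 ≤ A → 0 ≤ G M N A ϑ η)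
    (hGmono : ∀ (M N A : ℝ) (ϑ : ℤ) (η : ℝ) (d : ℕ), 1 / 2 ≤ M → 1 / 2 ≤ A → 0 < d →
      (d : ℤ) ∣ ϑ → 1 / 2 ≤ N / d → G M (N / d) A (ϑ / d) (η / d) ≤ G M N A ϑ η)
    (hcore : ∀ (M N A : ℝ), 1 / 2 ≤ M → 1 / 2 ≤ N → N ≤ M → 1 / 2 ≤ A → ∀ (ϑ : ℤ), ϑ ≠ 0 →
      ∀ (η : ℝ) (α β ν : ℕ → ℂ),
      (∀ m : ℕ, α m ≠ 0 → M < m ∧ (m : ℝ) ≤ 2 * M) →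
      (∀ n : ℕ, β n ≠ 0 → N < n ∧ (n : ℝ) ≤ 2 * N) →
      (∀ a : ℕ, ν a ≠ 0 → A < a ∧ (a : ℝ) ≤ 2 * A) →
      (∀ n : ℕ, β n ≠ 0 → n.Coprime ϑ.natAbs) →
      ‖∑ a ∈ Icc 1 ⌊2 * A⌋₊, ∑ m ∈ Icc 1 ⌊2 * M⌋₊, ∑ n ∈ Icc 1 ⌊2 * N⌋₊,
          if m.Coprime n then
            α m * β n * ν a * Complex.exp (2 * Real.pi * Complex.I *
              ((ϑ : ℂ) * (a : ℂ) * ((((m : ZMod n)⁻¹).val : ℕ) : ℂ) / (n : ℂ) +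
                (η : ℂ) * (a : ℂ) / ((m : ℂ) * (n : ℂ))))
          else 0‖ ≤
        Real.sqrt (∑ m ∈ Icc 1 ⌊2 * M⌋₊, ‖α m‖ ^ 2) *
          Real.sqrt (∑ n ∈ Icc 1 ⌊2 * N⌋₊, ‖β n‖ ^ 2) *
          Real.sqrt (∑ a ∈ Icc 1 ⌊2 * A⌋₊, ‖ν a‖ ^ 2) * G M N A ϑ η)
    (M N A : ℝ) (hM : 1 / 2 ≤ M) (hN : 1 / 2 ≤ N) (hNM : N ≤ M) (hA : 1 / 2 ≤ A)
    (ϑ : ℤ) (hϑ : ϑ ≠ 0) (η : ℝ) (α β ν : ℕ → ℂ)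
    (hα : ∀ m : ℕ, α m ≠ 0 → M < m ∧ (m : ℝ) ≤ 2 * M)
    (hβ : ∀ n : ℕ, β n ≠ 0 → N < n ∧ (n : ℝ) ≤ 2 * N)
    (hν : ∀ a : ℕ, ν a ≠ 0 → A < a ∧ (a : ℝ) ≤ 2 * A) :
    ‖∑ a ∈ Icc 1 ⌊2 * A⌋₊, ∑ m ∈ Icc 1 ⌊2 * M⌋₊, ∑ n ∈ Icc 1 ⌊2 * N⌋₊,
        if m.Coprime n then
          α m * β n * ν a * Complex.exp (2 * Real.pi * Complex.I *
            ((ϑ : ℂ) * (a : ℂ) * ((((m : ZMod n)⁻¹).val : ℕ) : ℂ) / (n : ℂ) +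
              (η : ℂ) * (a : ℂ) / ((m : ℂ) * (n : ℂ))))
        else 0‖ ≤
      Real.sqrt (ϑ.natAbs.divisors.card : ℝ) * Real.sqrt (∑ m ∈ Icc 1 ⌊2 * M⌋₊, ‖α m‖ ^ 2) *
        Real.sqrt (∑ n ∈ Icc 1 ⌊2 * N⌋₊, ‖β n‖ ^ 2) *
        Real.sqrt (∑ a ∈ Icc 1 ⌊2 * A⌋₊, ‖ν a‖ ^ 2) * G M N A ϑ η := by
  have hN0 : 0 < N := by linarith
  rw [BC_trilinear_tw_eq_sum_divisors M N A hϑ η α β ν]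
  set nα : ℝ := Real.sqrt (∑ m ∈ Icc 1 ⌊2 * M⌋₊, ‖α m‖ ^ 2) with hnα
  set nν : ℝ := Real.sqrt (∑ a ∈ Icc 1 ⌊2 * A⌋₊, ‖ν a‖ ^ 2) with hnν
  set nβd : ℕ → ℝ := fun d => Real.sqrt (∑ n' ∈ Icc 1 ⌊2 * (N / d)⌋₊,
    ‖(if n'.Coprime (ϑ.natAbs / d) then β (d * n') else 0)‖ ^ 2) with hnβd
  have hGMN := hG0 M N A ϑ η hM hN hA
  -- each piece is bounded by `nα · nβd d · nν · G`
  have hpiece : ∀ d ∈ ϑ.natAbs.divisors,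
      ‖∑ a ∈ Icc 1 ⌊2 * A⌋₊, ∑ m ∈ Icc 1 ⌊2 * M⌋₊, ∑ n' ∈ Icc 1 ⌊2 * (N / d)⌋₊,
        if m.Coprime n' then
          (if m.Coprime d then α m else 0) *
            (if n'.Coprime (ϑ.natAbs / d) then β (d * n') else 0) * ν a *
            Complex.exp (2 * Real.pi * Complex.I *
              (((ϑ / d : ℤ) : ℂ) * (a : ℂ) * ((((m : ZMod n')⁻¹).val : ℕ) : ℂ) / (n' : ℂ) +
                ((η / d : ℝ) : ℂ) * (a : ℂ) / ((m : ℂ) * (n' : ℂ))))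
        else 0‖ ≤ nα * nβd d * nν * G M N A ϑ η := by
    intro d hd
    have hd0 : 0 < d := Nat.pos_of_mem_divisors hd
    have hdk : (d : ℤ) ∣ ϑ := Int.natCast_dvd.mpr (Nat.dvd_of_mem_divisors hd)
    have hd0r : (0 : ℝ) < d := by exact_mod_cast hd0
    have hd1r : (1 : ℝ) ≤ d := by exact_mod_cast hd0
    by_cases hNd : 1 / 2 ≤ N / d
    · -- apply the coprime-case bound at `(M, N/d, A, ϑ/d, η/d)`
      have hkd : ϑ / d ≠ 0 := by
        intro h0
        have : ϑ = 0 := by rw [← Int.ediv_mul_cancel hdk, h0, zero_mul]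
        exact hϑ this
      have hNdM : N / d ≤ M := (div_le_self hN0.le hd1r).trans hNM
      have hα' : ∀ m : ℕ, (if m.Coprime d then α m else 0) ≠ 0 → M < m ∧ (m : ℝ) ≤ 2 * M := by
        intro m hm
        refine hα m fun h0 => hm ?_
        simp [h0]
      have hβ' : ∀ n' : ℕ, (if n'.Coprime (ϑ.natAbs / d) then β (d * n') else 0) ≠ 0 →
          N / d < n' ∧ (n' : ℝ) ≤ 2 * (N / d) := by
        intro n' hn'
        by_cases hc : n'.Coprime (ϑ.natAbs / d)
        · rw [if_pos hc] at hn'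
          obtain ⟨h1, h2⟩ := hβ (d * n') hn'
          push_cast at h1 h2
          constructor
          · rw [div_lt_iff₀ hd0r]; linarith
          · rw [show 2 * (N / d) = 2 * N / d by ring, le_div_iff₀ hd0r]; linarith
        · exact absurd (by rw [if_neg hc]) hn'
      have hβ'' : ∀ n' : ℕ, (if n'.Coprime (ϑ.natAbs / d) then β (d * n') else 0) ≠ 0 →
          n'.Coprime (ϑ / d).natAbs := by
        intro n' hn'
        by_cases hc : n'.Coprime (ϑ.natAbs / d)
        · rwa [Int.natAbs_ediv_of_dvd hdk, Int.natAbs_natCast]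
        · exact absurd (by rw [if_neg hc]) hn'
      have h := hcore M (N / d) A hM hNd hNdM hA (ϑ / d) hkd (η / d) _ _ ν hα' hβ' hν hβ''
      refine h.trans ?_
      have hαle : Real.sqrt (∑ m ∈ Icc 1 ⌊2 * M⌋₊, ‖(if m.Coprime d then α m else 0)‖ ^ 2) ≤
          nα := by
        refine Real.sqrt_le_sqrt (Finset.sum_le_sum fun m _ => ?_)
        split_ifs <;> simp
      have hG := hGmono M N A ϑ η d hM hA hd0 hdk hNd
      have := hG0 M (N / d) A (ϑ / d) (η / d) hM hNd hA
      have hnν0 : 0 ≤ nν := Real.sqrt_nonneg _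
      calc _ ≤ nα * nβd d * nν * G M (N / d) A (ϑ / d) (η / d) := by gcongr
        _ ≤ _ := by gcongr
    · -- `N/d < 1/2`: the box `1 ≤ n' ≤ 2N/d` is empty
      have hfl : ⌊2 * (N / d)⌋₊ = 0 := Nat.floor_eq_zero.mpr (by linarith [not_le.mp hNd])
      rw [hfl]
      simp only [show Icc 1 0 = (∅ : Finset ℕ) by rfl, Finset.sum_empty, Finset.sum_const_zero,
        norm_zero]
      positivity
  -- Cauchy–Schwarz over `d`
  have hCS : ∑ d ∈ ϑ.natAbs.divisors, nβd d ≤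
      Real.sqrt (ϑ.natAbs.divisors.card) * Real.sqrt (∑ n ∈ Icc 1 ⌊2 * N⌋₊, ‖β n‖ ^ 2) := by
    have h1 : (∑ d ∈ ϑ.natAbs.divisors, nβd d) ^ 2 ≤
        ϑ.natAbs.divisors.card * ∑ n ∈ Icc 1 ⌊2 * N⌋₊, ‖β n‖ ^ 2 := by
      calc (∑ d ∈ ϑ.natAbs.divisors, nβd d) ^ 2
          ≤ ϑ.natAbs.divisors.card * ∑ d ∈ ϑ.natAbs.divisors, nβd d ^ 2 :=
            sq_sum_le_card_mul_sum_sq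
        _ = ϑ.natAbs.divisors.card * ∑ n ∈ Icc 1 ⌊2 * N⌋₊, ‖β n‖ ^ 2 := by
            rw [← DFI_sum_divisors_normSq_eq hϑ N β]
            congr 1
            refine Finset.sum_congr rfl fun d _ => ?_
            exact Real.sq_sqrt (Finset.sum_nonneg fun _ _ => sq_nonneg _)
    calc ∑ d ∈ ϑ.natAbs.divisors, nβd d = Real.sqrt ((∑ d ∈ ϑ.natAbs.divisors, nβd d) ^ 2) :=
          (Real.sqrt_sq (Finset.sum_nonneg fun _ _ => Real.sqrt_nonneg _)).symm
      _ ≤ Real.sqrt (ϑ.natAbs.divisors.card * ∑ n ∈ Icc 1 ⌊2 * N⌋₊, ‖β n‖ ^ 2) :=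
          Real.sqrt_le_sqrt h1
      _ = _ := Real.sqrt_mul (Nat.cast_nonneg _) _
  have hnα0 : 0 ≤ nα := Real.sqrt_nonneg _
  have hnν0 : 0 ≤ nν := Real.sqrt_nonneg _
  calc _ ≤ ∑ d ∈ ϑ.natAbs.divisors, ‖∑ a ∈ Icc 1 ⌊2 * A⌋₊, ∑ m ∈ Icc 1 ⌊2 * M⌋₊,
        ∑ n' ∈ Icc 1 ⌊2 * (N / d)⌋₊,
        if m.Coprime n' then
          (if m.Coprime d then α m else 0) *
            (if n'.Coprime (ϑ.natAbs / d) then β (d * n') else 0) * ν a *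
            Complex.exp (2 * Real.pi * Complex.I *
              (((ϑ / d : ℤ) : ℂ) * (a : ℂ) * ((((m : ZMod n')⁻¹).val : ℕ) : ℂ) / (n' : ℂ) +
                ((η / d : ℝ) : ℂ) * (a : ℂ) / ((m : ℂ) * (n' : ℂ))))
        else 0‖ := norm_sum_le _ _
    _ ≤ ∑ d ∈ ϑ.natAbs.divisors, nα * nβd d * nν * G M N A ϑ η := Finset.sum_le_sum hpiece
    _ = nα * nν * G M N A ϑ η * ∑ d ∈ ϑ.natAbs.divisors, nβd d := by
        rw [Finset.mul_sum]
        refine Finset.sum_congr rfl fun d _ => ?_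
        ring
    _ ≤ nα * nν * G M N A ϑ η * (Real.sqrt (ϑ.natAbs.divisors.card) *
          Real.sqrt (∑ n ∈ Icc 1 ⌊2 * N⌋₊, ‖β n‖ ^ 2)) := by gcongr
    _ = _ := by ring

/-! ### Cauchy–Schwarz in `m` (Bettin–Chandee (bfc)) for the twisted trilinear form -/

/-- **`𝓑^{tw} ≤ ‖α‖ (𝓒₁^{tw})^{1/2}`** for the twisted trilinear form, with the `m`-sum of the
second moment restricted to the support `(⌊M⌋, ⌊2M⌋]` of `α`:
`𝓒₁^{tw} = ∑_{M<m≤2M} |∑_a ∑_{n,(m,n)=1} β_n ν_a e(ϑ a m̄/n + η a/(mn))|²` (Bettin–Chandee §2 (bfc),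
`𝓑(M,N,A) ≪ ‖α‖ 𝓒₁^{1/2}`, via the tree's `kfB_dyadic_CS`). [cite: BettinChandee2018, §2 (bfc)] -/
theorem BC_trilinear_tw_le_norm_mul_sqrt_C1A (M N A : ℝ) (ϑ : ℤ) (η : ℝ) (α β ν : ℕ → ℂ)
    (hα : ∀ m : ℕ, α m ≠ 0 → M < m ∧ (m : ℝ) ≤ 2 * M) :
    ‖∑ a ∈ Icc 1 ⌊2 * A⌋₊, ∑ m ∈ Icc 1 ⌊2 * M⌋₊, ∑ n ∈ Icc 1 ⌊2 * N⌋₊,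
        if m.Coprime n then
          α m * β n * ν a * Complex.exp (2 * Real.pi * Complex.I *
            ((ϑ : ℂ) * (a : ℂ) * ((((m : ZMod n)⁻¹).val : ℕ) : ℂ) / (n : ℂ) +
              (η : ℂ) * (a : ℂ) / ((m : ℂ) * (n : ℂ))))
        else 0‖ ≤
      Real.sqrt (∑ m ∈ Icc 1 ⌊2 * M⌋₊, ‖α m‖ ^ 2) *
        Real.sqrt (∑ m ∈ Ioc ⌊M⌋₊ ⌊2 * M⌋₊, ‖∑ a ∈ Icc 1 ⌊2 * A⌋₊, ∑ n ∈ Icc 1 ⌊2 * N⌋₊,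
          if m.Coprime n then
            β n * ν a * Complex.exp (2 * Real.pi * Complex.I *
              ((ϑ : ℂ) * (a : ℂ) * ((((m : ZMod n)⁻¹).val : ℕ) : ℂ) / (n : ℂ) +
                (η : ℂ) * (a : ℂ) / ((m : ℂ) * (n : ℂ))))
          else 0‖ ^ 2) := by
  set X : ℕ → ℂ := fun m => ∑ a ∈ Icc 1 ⌊2 * A⌋₊, ∑ n ∈ Icc 1 ⌊2 * N⌋₊,
    if m.Coprime n then
      β n * ν a * Complex.exp (2 * Real.pi * Complex.I *
        ((ϑ : ℂ) * (a : ℂ) * ((((m : ZMod n)⁻¹).val : ℕ) : ℂ) / (n : ℂ) +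
          (η : ℂ) * (a : ℂ) / ((m : ℂ) * (n : ℂ))))
    else 0 with hX
  have hswap : (∑ a ∈ Icc 1 ⌊2 * A⌋₊, ∑ m ∈ Icc 1 ⌊2 * M⌋₊, ∑ n ∈ Icc 1 ⌊2 * N⌋₊,
      if m.Coprime n then
        α m * β n * ν a * Complex.exp (2 * Real.pi * Complex.I *
          ((ϑ : ℂ) * (a : ℂ) * ((((m : ZMod n)⁻¹).val : ℕ) : ℂ) / (n : ℂ) +
            (η : ℂ) * (a : ℂ) / ((m : ℂ) * (n : ℂ))))
      else 0) = ∑ m ∈ Icc 1 ⌊2 * M⌋₊, α m * X m := by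
    rw [Finset.sum_comm]
    refine Finset.sum_congr rfl fun m _ => ?_
    rw [hX, Finset.mul_sum]
    refine Finset.sum_congr rfl fun a _ => ?_
    rw [Finset.mul_sum]
    refine Finset.sum_congr rfl fun n _ => ?_
    split_ifs
    · ring
    · rw [mul_zero]
  rw [hswap]
  exact kfB_dyadic_CS M α X hα

/-! ### From (6.4) (general `A`, twisted) to (7.3) -/

/-- **The exponents: square roots of the (6.4)-terms against the (7.3)-terms.**  For
`A ≥ 1/2`, `0 < N ≤ M`,
`(AMN^{3/4} + AN^{7/4} + A^{2/5}M^{6/5}N^{7/10} + A^{7/10}M^{3/5}N^{13/10})^{1/2} ≤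
3 (A^{1/2}M^{1/2}N^{3/8} + A^{7/20}M^{3/5}N^{7/20})` (`AN^{7/4} ≤ AMN^{3/4}` and
`A^{7/10}M^{3/5}N^{13/10} ≤ A^{7/10}M^{6/5}N^{7/10}` for `N ≤ M`; `A^{2/5} ≤ 2 A^{7/10}` for
`A ≥ 1/2`).  (Bettin–Chandee §7: "(7.1) … If `M ≥ N` this implies (7.2)".)
[cite: BettinChandee2018, §7 ((7.1) ⟹ (7.2))] -/
theorem BC_sqrt_terms64A_le {A M N : ℝ} (hA : 1 / 2 ≤ A) (hN : 0 < N) (hNM : N ≤ M) :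
    Real.sqrt (A * M * N ^ (3 / 4 : ℝ) + A * N ^ (7 / 4 : ℝ) +
        A ^ (2 / 5 : ℝ) * M ^ (6 / 5 : ℝ) * N ^ (7 / 10 : ℝ) +
        A ^ (7 / 10 : ℝ) * M ^ (3 / 5 : ℝ) * N ^ (13 / 10 : ℝ)) ≤
      3 * (A ^ (1 / 2 : ℝ) * M ^ (1 / 2 : ℝ) * N ^ (3 / 8 : ℝ) +
        A ^ (7 / 20 : ℝ) * M ^ (3 / 5 : ℝ) * N ^ (7 / 20 : ℝ)) := by
  have hA0 : 0 < A := by linarith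
  have hM0 : 0 < M := lt_of_lt_of_le hN hNM
  obtain ⟨la, hla⟩ : ∃ la : ℝ, la = Real.log A := ⟨_, rfl⟩
  obtain ⟨u, hu⟩ : ∃ u : ℝ, u = Real.log M := ⟨_, rfl⟩
  obtain ⟨v, hv⟩ : ∃ v : ℝ, v = Real.log N := ⟨_, rfl⟩
  have huv : v ≤ u := by rw [hu, hv]; exact Real.log_le_log hN hNM
  have hla2 : -Real.log 2 ≤ la := by
    rw [hla, ← Real.log_inv]
    exact Real.log_le_log (by norm_num) (by rw [inv_eq_one_div]; exact hA)
  have hl2 : 0 ≤ Real.log 2 := Real.log_nonneg (by norm_num)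
  have eA : ∀ c : ℝ, A ^ c = Real.exp (c * la) := fun c => by
    rw [Real.rpow_def_of_pos hA0, mul_comm, hla]
  have eM : ∀ c : ℝ, M ^ c = Real.exp (c * u) := fun c => by
    rw [Real.rpow_def_of_pos hM0, mul_comm, hu]
  have eN : ∀ c : ℝ, N ^ c = Real.exp (c * v) := fun c => by
    rw [Real.rpow_def_of_pos hN, mul_comm, hv]
  have eA1 : A = Real.exp la := by rw [hla, Real.exp_log hA0]
  have eM1 : M = Real.exp u := by rw [hu, Real.exp_log hM0]
  set T1 := A ^ (1 / 2 : ℝ) * M ^ (1 / 2 : ℝ) * N ^ (3 / 8 : ℝ) with hT1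
  set T2 := A ^ (7 / 20 : ℝ) * M ^ (3 / 5 : ℝ) * N ^ (7 / 20 : ℝ) with hT2
  have hT1e : T1 = Real.exp (1 / 2 * la + 1 / 2 * u + 3 / 8 * v) := by
    rw [hT1, eA, eM, eN, ← Real.exp_add, ← Real.exp_add]
  have hT2e : T2 = Real.exp (7 / 20 * la + 3 / 5 * u + 7 / 20 * v) := by
    rw [hT2, eA, eM, eN, ← Real.exp_add, ← Real.exp_add]
  have hsq : ∀ x : ℝ, Real.exp x ^ 2 = Real.exp (2 * x) := fun x => by
    rw [sq, ← Real.exp_add]; ring_nf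
  have h1 : A * M * N ^ (3 / 4 : ℝ) ≤ T1 ^ 2 := by
    rw [hT1e, hsq, eN]
    rw [eA1, eM1, ← Real.exp_add, ← Real.exp_add]
    exact Real.exp_le_exp.mpr (by linarith)
  have h2 : A * N ^ (7 / 4 : ℝ) ≤ T1 ^ 2 := by
    rw [hT1e, hsq, eN]
    rw [eA1, ← Real.exp_add]
    exact Real.exp_le_exp.mpr (by linarith)
  have h3 : A ^ (2 / 5 : ℝ) * M ^ (6 / 5 : ℝ) * N ^ (7 / 10 : ℝ) ≤ 2 * T2 ^ 2 := by
    rw [hT2e, hsq, eA, eM, eN, ← Real.exp_add, ← Real.exp_add]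
    have h := Real.exp_le_exp.mpr (show 2 / 5 * la + 6 / 5 * u + 7 / 10 * v ≤
        2 * (7 / 20 * la + 3 / 5 * u + 7 / 20 * v) + Real.log 2 by linarith)
    rw [Real.exp_add (2 * (7 / 20 * la + 3 / 5 * u + 7 / 20 * v)) (Real.log 2),
      Real.exp_log (by norm_num : (0 : ℝ) < 2)] at h
    linarith
  have h4 : A ^ (7 / 10 : ℝ) * M ^ (3 / 5 : ℝ) * N ^ (13 / 10 : ℝ) ≤ T2 ^ 2 := by
    rw [hT2e, hsq, eA, eM, eN, ← Real.exp_add, ← Real.exp_add]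
    exact Real.exp_le_exp.mpr (by linarith)
  have hT10 : 0 ≤ T1 := by rw [hT1e]; exact (Real.exp_pos _).le
  have hT20 : 0 ≤ T2 := by rw [hT2e]; exact (Real.exp_pos _).le
  have hS : A * M * N ^ (3 / 4 : ℝ) + A * N ^ (7 / 4 : ℝ) +
        A ^ (2 / 5 : ℝ) * M ^ (6 / 5 : ℝ) * N ^ (7 / 10 : ℝ) +
        A ^ (7 / 10 : ℝ) * M ^ (3 / 5 : ℝ) * N ^ (13 / 10 : ℝ) ≤ (3 * (T1 + T2)) ^ 2 := by
    have e : (3 * (T1 + T2)) ^ 2 = 9 * T1 ^ 2 + 18 * (T1 * T2) + 9 * T2 ^ 2 := by ring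
    rw [e]
    nlinarith [mul_nonneg hT10 hT20, sq_nonneg T1, sq_nonneg T2]
  calc _ ≤ Real.sqrt ((3 * (T1 + T2)) ^ 2) := Real.sqrt_le_sqrt hS
    _ = 3 * (T1 + T2) := Real.sqrt_sq (by positivity)


/-- **(7.3) at one instance from the (6.4)-type bound** (Cauchy–Schwarz in `m` and
`BC_sqrt_terms64A_le`): if `1/2 ≤ N ≤ M`, `A ≥ 1/2` and
`𝓒₁^{tw} ≤ K ‖β‖²‖ν‖² E^ε (1 + (|ϑ|+|η|)A/(MN)) (AMN^{3/4} + AN^{7/4} + A^{2/5}M^{6/5}N^{7/10} + A^{7/10}M^{3/5}N^{13/10})`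
(`E = (1+|ϑ|+|η|)AMN`), then for `α` on `(M, 2M]`,
`‖𝓑^{tw}‖ ≤ ‖α‖‖β‖‖ν‖ · 3√K E^{ε/2} (1 + (|ϑ|+|η|)A/(MN))^{1/2} (A^{1/2}M^{1/2}N^{3/8} + A^{7/20}M^{3/5}N^{7/20})`.
[cite: BettinChandee2018, §7 ((7.1)–(7.3))] -/
theorem BC_trilinear_tw_of_C1A_bound {K ε M N A : ℝ} (hK : 0 < K) (hN : 1 / 2 ≤ N)
    (hNM : N ≤ M) (hA : 1 / 2 ≤ A) {ϑ : ℤ} {η : ℝ} {α β ν : ℕ → ℂ}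
    (hα : ∀ m : ℕ, α m ≠ 0 → M < m ∧ (m : ℝ) ≤ 2 * M)
    (hC : ∑ m ∈ Ioc ⌊M⌋₊ ⌊2 * M⌋₊, ‖∑ a ∈ Icc 1 ⌊2 * A⌋₊, ∑ n ∈ Icc 1 ⌊2 * N⌋₊,
        (if m.Coprime n then
          β n * ν a * Complex.exp (2 * Real.pi * Complex.I *
            ((ϑ : ℂ) * (a : ℂ) * ((((m : ZMod n)⁻¹).val : ℕ) : ℂ) / (n : ℂ) +
              (η : ℂ) * (a : ℂ) / ((m : ℂ) * (n : ℂ))))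
        else 0)‖ ^ 2 ≤
      K * (∑ n ∈ Icc 1 ⌊2 * N⌋₊, ‖β n‖ ^ 2) * (∑ a ∈ Icc 1 ⌊2 * A⌋₊, ‖ν a‖ ^ 2) *
        ((1 + |(ϑ : ℝ)| + |η|) * (A * M * N)) ^ ε *
        (1 + (|(ϑ : ℝ)| + |η|) * A / (M * N)) *
        (A * M * N ^ (3 / 4 : ℝ) + A * N ^ (7 / 4 : ℝ) +
          A ^ (2 / 5 : ℝ) * M ^ (6 / 5 : ℝ) * N ^ (7 / 10 : ℝ) +
          A ^ (7 / 10 : ℝ) * M ^ (3 / 5 : ℝ) * N ^ (13 / 10 : ℝ))) :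
    ‖∑ a ∈ Icc 1 ⌊2 * A⌋₊, ∑ m ∈ Icc 1 ⌊2 * M⌋₊, ∑ n ∈ Icc 1 ⌊2 * N⌋₊,
        if m.Coprime n then
          α m * β n * ν a * Complex.exp (2 * Real.pi * Complex.I *
            ((ϑ : ℂ) * (a : ℂ) * ((((m : ZMod n)⁻¹).val : ℕ) : ℂ) / (n : ℂ) +
              (η : ℂ) * (a : ℂ) / ((m : ℂ) * (n : ℂ))))
        else 0‖ ≤
      Real.sqrt (∑ m ∈ Icc 1 ⌊2 * M⌋₊, ‖α m‖ ^ 2) *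
        Real.sqrt (∑ n ∈ Icc 1 ⌊2 * N⌋₊, ‖β n‖ ^ 2) *
        Real.sqrt (∑ a ∈ Icc 1 ⌊2 * A⌋₊, ‖ν a‖ ^ 2) *
        (3 * Real.sqrt K * ((1 + |(ϑ : ℝ)| + |η|) * (A * M * N)) ^ (ε / 2) *
          (1 + (|(ϑ : ℝ)| + |η|) * A / (M * N)) ^ (1 / 2 : ℝ) *
          (A ^ (1 / 2 : ℝ) * M ^ (1 / 2 : ℝ) * N ^ (3 / 8 : ℝ) +
            A ^ (7 / 20 : ℝ) * M ^ (3 / 5 : ℝ) * N ^ (7 / 20 : ℝ))) := by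
  have hN0 : 0 < N := by linarith
  have hM0 : 0 < M := lt_of_lt_of_le hN0 hNM
  have hA0 : 0 < A := by linarith
  have hE0 : 0 ≤ (1 + |(ϑ : ℝ)| + |η|) * (A * M * N) := by positivity
  have hW0 : 0 ≤ 1 + (|(ϑ : ℝ)| + |η|) * A / (M * N) := by positivity
  have h1 := BC_trilinear_tw_le_norm_mul_sqrt_C1A M N A ϑ η α β ν hα
  refine h1.trans ?_
  rw [mul_assoc (Real.sqrt (∑ m ∈ Icc 1 ⌊2 * M⌋₊, ‖α m‖ ^ 2)),
    mul_assoc (Real.sqrt (∑ m ∈ Icc 1 ⌊2 * M⌋₊, ‖α m‖ ^ 2))]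
  refine mul_le_mul_of_nonneg_left ?_ (Real.sqrt_nonneg _)
  refine (Real.sqrt_le_sqrt hC).trans ?_
  set nβ2 : ℝ := ∑ n ∈ Icc 1 ⌊2 * N⌋₊, ‖β n‖ ^ 2 with hnβ2
  set nν2 : ℝ := ∑ a ∈ Icc 1 ⌊2 * A⌋₊, ‖ν a‖ ^ 2 with hnν2
  have hnβ0 : 0 ≤ nβ2 := Finset.sum_nonneg fun _ _ => sq_nonneg _
  have hnν0 : 0 ≤ nν2 := Finset.sum_nonneg fun _ _ => sq_nonneg _
  rw [Real.sqrt_mul' _ (by positivity), Real.sqrt_mul' _ hW0, Real.sqrt_mul' _ (by positivity),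
    Real.sqrt_mul' _ hnν0, Real.sqrt_mul' _ hnβ0]
  have e1 : Real.sqrt (((1 + |(ϑ : ℝ)| + |η|) * (A * M * N)) ^ ε) =
      ((1 + |(ϑ : ℝ)| + |η|) * (A * M * N)) ^ (ε / 2) := by
    rw [Real.sqrt_eq_rpow, ← Real.rpow_mul hE0]; ring_nf
  have e2 : Real.sqrt (1 + (|(ϑ : ℝ)| + |η|) * A / (M * N)) =
      (1 + (|(ϑ : ℝ)| + |η|) * A / (M * N)) ^ (1 / 2 : ℝ) := Real.sqrt_eq_rpow _
  rw [e1, e2]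
  have h3 := BC_sqrt_terms64A_le hA hN0 hNM
  have hsK : 0 ≤ Real.sqrt K := Real.sqrt_nonneg _
  calc Real.sqrt K * Real.sqrt nβ2 * Real.sqrt nν2 *
        ((1 + |(ϑ : ℝ)| + |η|) * (A * M * N)) ^ (ε / 2) *
        (1 + (|(ϑ : ℝ)| + |η|) * A / (M * N)) ^ (1 / 2 : ℝ) *
        Real.sqrt (A * M * N ^ (3 / 4 : ℝ) + A * N ^ (7 / 4 : ℝ) +
          A ^ (2 / 5 : ℝ) * M ^ (6 / 5 : ℝ) * N ^ (7 / 10 : ℝ) +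
          A ^ (7 / 10 : ℝ) * M ^ (3 / 5 : ℝ) * N ^ (13 / 10 : ℝ))
      ≤ Real.sqrt K * Real.sqrt nβ2 * Real.sqrt nν2 *
        ((1 + |(ϑ : ℝ)| + |η|) * (A * M * N)) ^ (ε / 2) *
        (1 + (|(ϑ : ℝ)| + |η|) * A / (M * N)) ^ (1 / 2 : ℝ) *
        (3 * (A ^ (1 / 2 : ℝ) * M ^ (1 / 2 : ℝ) * N ^ (3 / 8 : ℝ) +
          A ^ (7 / 20 : ℝ) * M ^ (3 / 5 : ℝ) * N ^ (7 / 20 : ℝ))) := by gcongr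
    _ = _ := by ring

/-- **Bettin–Chandee (7.3) in the range `M ≥ N` from the (6.4)-type bound for the twisted
trilinear second moment** (general `A`).  Hypothesis ((6.4) with the twist of Remark 2, general
`A`, written out; `β` supported on `(N,2N]` AND coprime to `ϑ`, as the source assumes from §2 on;
the source's `(MN)^ε` under "`A, b, ϑ, N ≪ M^C`" rendered as `((1+|ϑ|+|η|)AMN)^ε`, and the factor
`(1 + (|ϑ|A + X)/(MN))` of Remark 2 with exponent `1` at the level of second moments): for every
`ε > 0` there is `K` with, for `1/2 ≤ N ≤ M`, `A ≥ 1/2`, `ϑ ≠ 0`, real `η`,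
`𝓒₁^{tw} = ∑_{M<m≤2M} |∑_a ∑_{n,(m,n)=1} β_n ν_a e(ϑ a m̄/n + η a/(mn))|² ≤
K ‖β‖²‖ν‖² ((1+|ϑ|+|η|)AMN)^ε (1 + (|ϑ|+|η|)A/(MN)) (AMN^{3/4} + AN^{7/4} + A^{2/5}M^{6/5}N^{7/10} + A^{7/10}M^{3/5}N^{13/10})`.
Conclusion: the hypothesis (7.3) of
`BettinChandee2018_trilinearKloostermanFractions_of_twisted73_MgeN`
(`TrilinearKloostermanFractionsReciprocity.lean`), for ALL `β` on `(N, 2N]`: Cauchy–Schwarz in `m`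
(`BC_trilinear_tw_of_C1A_bound`), then "we can assume that `β_n` is supported on integers coprime
to `ϑ` … pulling out the common factor between `n` and `ϑ` and applying the Cauchy–Schwarz
inequality" (`BC_trilinear_tw_bound_of_coprime_case`, cost `τ(|ϑ|)^{1/2} ≤ C|ϑ|^{ε/2}`, absorbed
into `((1+|ϑ|+|η|)AMN)^ε` since `AMN ≥ 1/8`). [cite: BettinChandee2018, §2 and §7 ((7.1)–(7.3))] -/
theorem BC_twisted73_MgeN_of_C1A_bound
    (hC : ∀ ε : ℝ, 0 < ε → ∃ K : ℝ, 0 < K ∧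
      ∀ (M N A : ℝ), 1 / 2 ≤ N → N ≤ M → 1 / 2 ≤ A → ∀ (ϑ : ℤ), ϑ ≠ 0 → ∀ (η : ℝ)
        (β ν : ℕ → ℂ),
        (∀ n : ℕ, β n ≠ 0 → N < n ∧ (n : ℝ) ≤ 2 * N) →
        (∀ a : ℕ, ν a ≠ 0 → A < a ∧ (a : ℝ) ≤ 2 * A) →
        (∀ n : ℕ, β n ≠ 0 → n.Coprime ϑ.natAbs) →
        ∑ m ∈ Ioc ⌊M⌋₊ ⌊2 * M⌋₊, ‖∑ a ∈ Icc 1 ⌊2 * A⌋₊, ∑ n ∈ Icc 1 ⌊2 * N⌋₊,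
            (if m.Coprime n then
              β n * ν a * Complex.exp (2 * Real.pi * Complex.I *
                ((ϑ : ℂ) * (a : ℂ) * ((((m : ZMod n)⁻¹).val : ℕ) : ℂ) / (n : ℂ) +
                  (η : ℂ) * (a : ℂ) / ((m : ℂ) * (n : ℂ))))
            else 0)‖ ^ 2 ≤
          K * (∑ n ∈ Icc 1 ⌊2 * N⌋₊, ‖β n‖ ^ 2) * (∑ a ∈ Icc 1 ⌊2 * A⌋₊, ‖ν a‖ ^ 2) *
            ((1 + |(ϑ : ℝ)| + |η|) * (A * M * N)) ^ ε *
            (1 + (|(ϑ : ℝ)| + |η|) * A / (M * N)) *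
            (A * M * N ^ (3 / 4 : ℝ) + A * N ^ (7 / 4 : ℝ) +
              A ^ (2 / 5 : ℝ) * M ^ (6 / 5 : ℝ) * N ^ (7 / 10 : ℝ) +
              A ^ (7 / 10 : ℝ) * M ^ (3 / 5 : ℝ) * N ^ (13 / 10 : ℝ))) :
    ∀ ε : ℝ, 0 < ε → ∃ K : ℝ, 0 < K ∧
      ∀ (M N A : ℝ), 1 / 2 ≤ N → N ≤ M → 1 / 2 ≤ A → ∀ (ϑ : ℤ), ϑ ≠ 0 → ∀ (η : ℝ)
        (α β ν : ℕ → ℂ),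
        (∀ m : ℕ, α m ≠ 0 → M < m ∧ (m : ℝ) ≤ 2 * M) →
        (∀ n : ℕ, β n ≠ 0 → N < n ∧ (n : ℝ) ≤ 2 * N) →
        (∀ a : ℕ, ν a ≠ 0 → A < a ∧ (a : ℝ) ≤ 2 * A) →
        ‖∑ a ∈ Icc 1 ⌊2 * A⌋₊, ∑ m ∈ Icc 1 ⌊2 * M⌋₊, ∑ n ∈ Icc 1 ⌊2 * N⌋₊,
            if m.Coprime n then
              α m * β n * ν a * Complex.exp (2 * Real.pi * Complex.I *
                ((ϑ : ℂ) * (a : ℂ) * ((((m : ZMod n)⁻¹).val : ℕ) : ℂ) / (n : ℂ) +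
                  (η : ℂ) * (a : ℂ) / ((m : ℂ) * (n : ℂ))))
            else 0‖ ≤
          K * Real.sqrt (∑ m ∈ Icc 1 ⌊2 * M⌋₊, ‖α m‖ ^ 2) *
            Real.sqrt (∑ n ∈ Icc 1 ⌊2 * N⌋₊, ‖β n‖ ^ 2) *
            Real.sqrt (∑ a ∈ Icc 1 ⌊2 * A⌋₊, ‖ν a‖ ^ 2) *
            ((1 + |(ϑ : ℝ)| + |η|) * (A * M * N)) ^ ε *
            (1 + (|(ϑ : ℝ)| + |η|) * A / (M * N)) ^ (1 / 2 : ℝ) *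
            (A ^ (1 / 2 : ℝ) * M ^ (1 / 2 : ℝ) * N ^ (3 / 8 : ℝ) +
              A ^ (7 / 20 : ℝ) * M ^ (3 / 5 : ℝ) * N ^ (7 / 20 : ℝ)) := by
  intro ε hε
  obtain ⟨K, hK, hCK⟩ := hC ε hε
  obtain ⟨C, hC0, hτ⟩ := DFI_sqrt_tau_le (η := ε / 2) (by positivity)
  refine ⟨3 * Real.sqrt K * C * (8 : ℝ) ^ (ε / 2), by positivity, ?_⟩
  intro M N A hN hNM hA ϑ hϑ η α β ν hα hβ hν
  have hN0 : 0 < N := by linarith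
  have hM0 : 0 < M := lt_of_lt_of_le hN0 hNM
  have hM : 1 / 2 ≤ M := hN.trans hNM
  have hA0 : 0 < A := by linarith
  -- the bound function of the coprime case
  set T : ℝ → ℝ → ℝ → ℝ := fun A' M' N' =>
    A' ^ (1 / 2 : ℝ) * M' ^ (1 / 2 : ℝ) * N' ^ (3 / 8 : ℝ) +
      A' ^ (7 / 20 : ℝ) * M' ^ (3 / 5 : ℝ) * N' ^ (7 / 20 : ℝ) with hT
  set G : ℝ → ℝ → ℝ → ℤ → ℝ → ℝ := fun M' N' A' ϑ' η' =>
    3 * Real.sqrt K * ((1 + |(ϑ' : ℝ)| + |η'|) * (A' * M' * N')) ^ (ε / 2) *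
      (1 + (|(ϑ' : ℝ)| + |η'|) * A' / (M' * N')) ^ (1 / 2 : ℝ) * T A' M' N' with hG
  have hT0 : ∀ A' M' N' : ℝ, 0 < A' → 0 < M' → 0 < N' → 0 ≤ T A' M' N' := by
    intro A' M' N' hA' hM' hN'; simp only [hT]; positivity
  have hG0 : ∀ (M' N' A' : ℝ) (ϑ' : ℤ) (η' : ℝ), 1 / 2 ≤ M' → 1 / 2 ≤ N' → 1 / 2 ≤ A' →
      0 ≤ G M' N' A' ϑ' η' := by
    intro M' N' A' ϑ' η' hM' hN' hA'
    have hM'0 : 0 < M' := by linarith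
    have hN'0 : 0 < N' := by linarith
    have hA'0 : 0 < A' := by linarith
    have := hT0 A' M' N' hA'0 hM'0 hN'0
    simp only [hG]
    positivity
  have hGmono : ∀ (M' N' A' : ℝ) (ϑ' : ℤ) (η' : ℝ) (d : ℕ), 1 / 2 ≤ M' → 1 / 2 ≤ A' → 0 < d →
      (d : ℤ) ∣ ϑ' → 1 / 2 ≤ N' / d → G M' (N' / d) A' (ϑ' / d) (η' / d) ≤ G M' N' A' ϑ' η' := by
    intro M' N' A' ϑ' η' d hM' hA' hd hdk hNd
    have hM'0 : 0 < M' := by linarith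
    have hA'0 : 0 < A' := by linarith
    have hd0 : (0 : ℝ) < d := by exact_mod_cast hd
    have hd1 : (1 : ℝ) ≤ d := by exact_mod_cast hd
    have hNd0 : 0 < N' / d := by linarith
    have hN'0 : 0 < N' := by
      have := mul_pos hNd0 hd0
      rwa [div_mul_cancel₀ _ hd0.ne'] at this
    have hNdle : N' / d ≤ N' := div_le_self hN'0.le hd1
    have hcast : ((ϑ' / d : ℤ) : ℝ) = (ϑ' : ℝ) / d := by
      rw [Int.cast_div hdk (by exact_mod_cast hd.ne')]; push_cast; ring
    have habsϑ : |((ϑ' / d : ℤ) : ℝ)| = |(ϑ' : ℝ)| / d := by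
      rw [hcast, abs_div, abs_of_pos hd0]
    have habsη : |η' / d| = |η'| / d := by rw [abs_div, abs_of_pos hd0]
    have hϑle : |(ϑ' : ℝ)| / d ≤ |(ϑ' : ℝ)| := div_le_self (abs_nonneg _) hd1
    have hηle : |η'| / d ≤ |η'| := div_le_self (abs_nonneg _) hd1
    simp only [hG, hT, habsϑ, habsη]
    have hE : (1 + |(ϑ' : ℝ)| / d + |η'| / d) * (A' * M' * (N' / d)) ≤
        (1 + |(ϑ' : ℝ)| + |η'|) * (A' * M' * N') := by gcongr
    have hW : 1 + (|(ϑ' : ℝ)| / d + |η'| / d) * A' / (M' * (N' / d)) =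
        1 + (|(ϑ' : ℝ)| + |η'|) * A' / (M' * N') := by
      field_simp
    rw [hW]
    have hsK : 0 ≤ Real.sqrt K := Real.sqrt_nonneg _
    have hE0 : 0 ≤ (1 + |(ϑ' : ℝ)| / d + |η'| / d) * (A' * M' * (N' / d)) := by positivity
    gcongr
  have hcore : ∀ (M' N' A' : ℝ), 1 / 2 ≤ M' → 1 / 2 ≤ N' → N' ≤ M' → 1 / 2 ≤ A' →
      ∀ (ϑ' : ℤ), ϑ' ≠ 0 → ∀ (η' : ℝ) (α' β' ν' : ℕ → ℂ),
      (∀ m : ℕ, α' m ≠ 0 → M' < m ∧ (m : ℝ) ≤ 2 * M') →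
      (∀ n : ℕ, β' n ≠ 0 → N' < n ∧ (n : ℝ) ≤ 2 * N') →
      (∀ a : ℕ, ν' a ≠ 0 → A' < a ∧ (a : ℝ) ≤ 2 * A') →
      (∀ n : ℕ, β' n ≠ 0 → n.Coprime ϑ'.natAbs) →
      ‖∑ a ∈ Icc 1 ⌊2 * A'⌋₊, ∑ m ∈ Icc 1 ⌊2 * M'⌋₊, ∑ n ∈ Icc 1 ⌊2 * N'⌋₊,
          if m.Coprime n then
            α' m * β' n * ν' a * Complex.exp (2 * Real.pi * Complex.I *
              ((ϑ' : ℂ) * (a : ℂ) * ((((m : ZMod n)⁻¹).val : ℕ) : ℂ) / (n : ℂ) +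
                (η' : ℂ) * (a : ℂ) / ((m : ℂ) * (n : ℂ))))
          else 0‖ ≤
        Real.sqrt (∑ m ∈ Icc 1 ⌊2 * M'⌋₊, ‖α' m‖ ^ 2) *
          Real.sqrt (∑ n ∈ Icc 1 ⌊2 * N'⌋₊, ‖β' n‖ ^ 2) *
          Real.sqrt (∑ a ∈ Icc 1 ⌊2 * A'⌋₊, ‖ν' a‖ ^ 2) * G M' N' A' ϑ' η' := by
    intro M' N' A' hM' hN' hNM' hA' ϑ' hϑ' η' α' β' ν' hα' hβ' hν' hβc
    have h := BC_trilinear_tw_of_C1A_bound hK hN' hNM' hA' hα'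
      (hCK M' N' A' hN' hNM' hA' ϑ' hϑ' η' β' ν' hβ' hν' hβc)
    simpa only [hG, hT] using h
  have hred := BC_trilinear_tw_bound_of_coprime_case G hG0 hGmono hcore M N A hM hN hNM hA ϑ hϑ η
    α β ν hα hβ hν
  refine hred.trans ?_
  -- `τ(|ϑ|)^{1/2} ≤ C |ϑ|^{ε/2} ≤ C 8^{ε/2} E^{ε/2}`
  set E : ℝ := (1 + |(ϑ : ℝ)| + |η|) * (A * M * N) with hE
  have hE0 : 0 ≤ E := by positivity
  have hϑE : |(ϑ : ℝ)| ≤ 8 * E := by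
    have hP : 1 / 8 ≤ A * M * N := by
      have h1 : (1 / 2 : ℝ) * (1 / 2) ≤ A * M := mul_le_mul hA hM (by norm_num) hA0.le
      have h2 : (1 / 2 : ℝ) * (1 / 2) * (1 / 2) ≤ A * M * N :=
        mul_le_mul h1 hN (by norm_num) (by positivity)
      linarith
    have h3 : |(ϑ : ℝ)| ≤ 1 + |(ϑ : ℝ)| + |η| := by linarith [abs_nonneg η]
    have h4 : 0 ≤ 1 + |(ϑ : ℝ)| + |η| := by positivity
    calc |(ϑ : ℝ)| ≤ (1 + |(ϑ : ℝ)| + |η|) * 1 := by linarith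
      _ ≤ (1 + |(ϑ : ℝ)| + |η|) * (8 * (A * M * N)) := by gcongr; linarith
      _ = 8 * E := by rw [hE]; ring
  have hτ' : Real.sqrt (ϑ.natAbs.divisors.card : ℝ) ≤ C * (8 : ℝ) ^ (ε / 2) * E ^ (ε / 2) := by
    calc Real.sqrt (ϑ.natAbs.divisors.card : ℝ) ≤ C * |(ϑ : ℝ)| ^ (ε / 2) := hτ ϑ hϑ
      _ ≤ C * (8 * E) ^ (ε / 2) := by
          gcongr
      _ = C * (8 : ℝ) ^ (ε / 2) * E ^ (ε / 2) := by
          rw [Real.mul_rpow (by norm_num) hE0]; ring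
  set nα := Real.sqrt (∑ m ∈ Icc 1 ⌊2 * M⌋₊, ‖α m‖ ^ 2) with hnα
  set nβ := Real.sqrt (∑ n ∈ Icc 1 ⌊2 * N⌋₊, ‖β n‖ ^ 2) with hnβ
  set nν := Real.sqrt (∑ a ∈ Icc 1 ⌊2 * A⌋₊, ‖ν a‖ ^ 2) with hnν
  have hnα0 : 0 ≤ nα := Real.sqrt_nonneg _
  have hnβ0 : 0 ≤ nβ := Real.sqrt_nonneg _
  have hnν0 : 0 ≤ nν := Real.sqrt_nonneg _
  have hW0 : 0 ≤ (1 + (|(ϑ : ℝ)| + |η|) * A / (M * N)) ^ (1 / 2 : ℝ) := by positivity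
  have hTMN : 0 ≤ T A M N := hT0 A M N hA0 hM0 hN0
  have hGval : G M N A ϑ η = 3 * Real.sqrt K * E ^ (ε / 2) *
      (1 + (|(ϑ : ℝ)| + |η|) * A / (M * N)) ^ (1 / 2 : ℝ) * T A M N := by
    simp only [hG, hE]
  rw [hGval]
  have hEE : E ^ (ε / 2) * E ^ (ε / 2) = E ^ ε := by
    rw [← Real.rpow_add' hE0 (by linarith)]; ring_nf
  calc Real.sqrt (ϑ.natAbs.divisors.card : ℝ) * nα * nβ * nν *
        (3 * Real.sqrt K * E ^ (ε / 2) * (1 + (|(ϑ : ℝ)| + |η|) * A / (M * N)) ^ (1 / 2 : ℝ) *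
          T A M N)
      ≤ (C * (8 : ℝ) ^ (ε / 2) * E ^ (ε / 2)) * nα * nβ * nν *
        (3 * Real.sqrt K * E ^ (ε / 2) * (1 + (|(ϑ : ℝ)| + |η|) * A / (M * N)) ^ (1 / 2 : ℝ) *
          T A M N) := by gcongr
    _ = 3 * Real.sqrt K * C * (8 : ℝ) ^ (ε / 2) * nα * nβ * nν * (E ^ (ε / 2) * E ^ (ε / 2)) *
        (1 + (|(ϑ : ℝ)| + |η|) * A / (M * N)) ^ (1 / 2 : ℝ) * T A M N := by ring
    _ = _ := by rw [hEE, hT]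

end Literature.NumberTheory.LFunctions

end
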